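import Literature.NumberTheory.EllipticCurves.BurungaleSkinnerTianWan2024.SupersingularTwistPPartOPEN
import Literature.NumberTheory.EllipticCurves.Rank1Residual.Typed.Basic
import Literature.NumberTheory.EllipticCurves.ModularityVersionApProofs
import Literature.NumberTheory.EllipticCurves.SupersingularDensitySerreFrobeniusProofs
import Literature.NumberTheory.EllipticCurves.ComplexMultiplication
import HarnessLib

/-!
# Burungale–Skinner–Tian–Wan (arXiv:2409.01350v2, PREPRINT), §10 — the QUADRATIC-TWIST clauses of the
# body theorems, for an elliptic curve: Cor. 10.2 (twist clause, BODY wording: `disc K` coprime to `Np`,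
# NO ordinarity restriction) and the `p ∣ M` step of the proof of Thm. 10.12 via Thm. 9.21 (c)
# (Kato's main conj. for `g ⊗ χ_K`, `p ∣ disc K`, nearly ordinary) — explicitly labelled OPEN binders
# (claim-tagged; NEVER facts) and their bookkeeping

Written by the typer seat `bsd-littype-01` (gen 2) of the cross-ladder literature-typing layer
(D-0088(4); cell `run/shared/lean/pub/bsd-littype/`). D-0064: one file for the twist clauses of §10
(§10.1.2 Cor. 10.2, §10.3.3 Thm. 10.12 with §9.4.1 Thm. 9.21 (c)). HONEST FRAMING: the source is an
UNREFEREED preprint; it enters ONLY as explicitly labelled OPEN hypotheses (`def … : Prop`,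
`[claim: …, status: under-review]`), NEVER as theorems or `[cite:]`-facts; nothing asserted about any
curve; nothing booked; no `_holds`. Theorems here take the binders as explicit hypotheses and are
bookkeeping between binders and to the tree's print-shape vocabulary (`Rank1Residual/PrintShape*`,
`Typed/Basic`), with published tree theorems BY NAME.

## Printed statements (arXiv:2409.01350v2; litref page file `pub/bsd-litref/bstw24/…/bstw24-v2-pages.json`)

* **Cor. 10.2** (p. 86; TeX label `BSD_f_Ko`, tex l.7328): "Let `g ∈ S₂(Γ₀(N))` be an elliptic newform
  with `N` square-free, and `F` the Hecke field with degree `d`. Let `A_g` be an associated `GL₂`-type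
  abelian variety over `ℚ`. Let `p ∤ 2N` be a prime so that `a_p(g) = 0`. If `ord_{s=1} L(s,g) = r ≤ 1`,
  then the `p`-part of the Birch and Swinnerton-Dyer conj[.] for `A_g` is true, that is,
  `rank_ℤ A_g(ℚ) = rd`, `Ш(A_g)[p^∞]` is finite and
  `|L^{(rd)}(1,A_g)/(d!·Ω_{A_g} R(A_g))|_p^{-1} = |#Ш(A_g)[p^∞] · ∏_{ℓ∣N} c_ℓ(A_g)|_p^{-1}`. Moreover,
  the same holds for `g ⊗ χ_K` for quadratic field extensions `K/ℚ` with discriminant coprime to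
  `Np`." — NOTE (OPEN-QUESTIONS-01 Q4, a LOCATED print-level discrepancy): the Introduction's
  Thm. 1.3/1.5/1.6 state the twist clause with the EXTRA restriction "and divisible only by primes of
  ordinary reduction for `E`"; the tree's binder `thm15_twist_pPart_OPEN` (sibling file
  `SupersingularTwistPPartOPEN.lean`) types the NARROWER introduction wording. This file types the body
  wording separately and PROVES that it implies the introduction binder (`thm15_twist_of_cor102_twist_OPEN`);
  the two are never merged.
* **Thm. 9.21 (c)** (p. 84; label `KaMC_r`, tex l.7164): "Let `p ∤ 6N` be an ordinary prime such that
  (irr_ℚ) holds. Then we have an equality of ideals `ξ(H¹(ℤ[1/p], T ⊗ Λ)/Λ_{𝒪_λ}·z_γ(g)) = ξ(X_st(g))`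
  in `Λ_{𝒪_λ} ⊗ ℚ_p`, which is an equality in `Λ_{𝒪_λ}` for primes `p ∤ 2N` if the following holds:
  (ram) There exists a prime `ℓ ∥ N` with `ρ̄` ramified at `ℓ`. Moreover, the equality also holds for
  the quadratic twist `g_K := g ⊗ χ_K`, where `K/ℚ` is a quadratic field extension with `p ∣ disc(K)`
  so that (ram_K) There exists a prime `ℓ ∤ D_K` as in (ram)." (Proof: "Note that `g_K` is nearly
  ordinary at `λ`. The Eisenstein congruence method of Skinner–Urban applies to this setting …".)
  The twist clause is the source's OWN new claim: Kato's main conj. for an elliptic curve with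
  ADDITIVE, potentially good ORDINARY reduction at `p` (a quadratic twist ramified at `p` of a good
  ordinary curve). Its MAIN-CONJ.-LEVEL form is NOT typed in Literature: the tree has no Kato-currency
  objects (`𝐇¹/Z`, `X_st`) for a curve additive at `p` (`Kato2004.DivisibilityInputs` is the good-ordinary
  package), and the branch currency in which the Summits-side K1 cell types the same announcement
  (`Summit.…Rank1Residual.Additive.ChiBranchLowerDivisibilityAt`, `ChiBranchLowerInput.lean`: "announced
  for `g ⊗ χ_K`, `p ∣ d_K`, `p ∤ 6N_g` by Burungale–Skinner–Tian–Wan") is a READING (prime-to-`p` descent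
  to the `ω^{(p−1)/2}`-branch) and lives Summits-side. What IS typable is its printed USE:
* **Thm. 10.12, proof, `p ∣ M` step** (p. 89; label `theoretic`, tex l.7535–7558): under the hypotheses
  of Thm. 10.12 (`E` semistable of conductor `N`, `M > 1` square-free, `(M,N) = 1`, (i) `L(1,E^{(M)}) ≠ 0`,
  (ii) the `2`-part of BSD for `E^{(M)}`, (iii) `a_3(E) = 0`, (iv) `E[p]` absolutely irreducible for all
  odd `p`, (v) for every `p ∣ N` a multiplicative `q ≠ p` at which `E[p]` is ramified, (vi) `E` ordinary
  at the primes dividing `M`): "In view of (ii), it suffices to consider the `p`-part of the BSD formula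
  for odd primes `p`. For such primes of good ordinary, multiplicative or supersingular reduction, the
  formula is the content of [SU, Thm. 2], [Sk, Thm. C] and Corollary 10.2, respectively. Lastly, for odd
  primes `p` dividing `M` it is a consequence of Theorem 9.21(c) (cf. the proof of Corollary 10.2)." —
  i.e. Kato's main conj. for `f_E ⊗ χ_{ℚ(√M)}` (Thm. 9.21 (c), `p ∣ disc ℚ(√M)`) descended to the
  rank-`0` `p`-part as in the proof of Cor. 10.2 ("[K, §14.20], [SU, Thm. 3.6.13], [JSW, §7.2]"). Note
  that (iii) with (vi) forces `3 ∤ M`, matching `p ∤ 6N` of Thm. 9.21 (c) (`five_le_of_thm1012Hypotheses`),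
  and that (ram_K) at a prime `p ∣ M` is not among (i)–(vi) (it holds for semistable `E` with `E[p]`
  irreducible by level-lowering — no weight-2 level-1 forms — an argument the proof leaves implicit;
  recorded in HOME/OPEN-QUESTIONS-01.md, g2 addendum).

## Transcription (dictionary of the sibling files; `E`-instances `A_g = E`, `d = 1`)

Cor. 10.2 twist clause: `W₀` a globally minimal model of `E` (`Semistable W₀` = "`N` square-free"),
`p ≠ 2`, good at `p` with `a_p(W₀) = 0` (the body's wording; at `p ≥ 5` the same as `GoodSS`, Hasse),
`K = ℚ(√d)` (`d` square-free, `d ≠ 1`), "discriminant coprime to `Np`" = every prime ramified in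
`ℚ(√d)` (`RamifiedInQuadratic d q`) is `≠ p` and does not divide `N_E`; `W` a globally minimal model of
`E^K` (`C • W = W₀.quadraticTwist d`); `r = ord_{s=1} L(s, E^K) ≤ 1` (`W.analyticRank ≤ 1`) ⇒
`rank_ℤ E^K(ℚ) = r ∧ Ш(E^K)[p^∞]` finite `∧` the no-torsion print shape for `W` at `p` (as
`thm15_twist_pPart_OPEN`, whose conclusion omits the first two conjuncts; `∏_{ℓ∣N} c_ℓ` read for the
twist as `W.tamagawaProduct`, all bad primes of `E^K` — at the additive primes `q ∣ disc K`, `q ≠ p`,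
`c_q(E^K) ∈ {1,2,4}` is a `p`-adic unit for odd `p`, so the two readings agree `p`-adically).
Thm. 10.12 frame: as in `ApplicationsPartIIOPEN.thm1012_fullBSD_rankZeroTwists_OPEN` (`M : ℕ`, `1 < M`,
`Squarefree M`, `Nat.Coprime M N`, `C • W = W₀.quadraticTwist M`, (i) `W.entireLFunction 1 ≠ 0`, (iii)
`W₀.frobeniusTrace 3 = 0`, (iv) `Irr W₀ p'` for odd primes `p'`, (v) `Ram W₀ p'` for `p' ∣ N`, (vi)
`GoodOrd W₀ q` for `q ∣ M`); hypothesis (ii) (`BSDp W 2`) is DROPPED in the `p ∣ M` binder because the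
printed proof uses it only to dispose of `p = 2` ("In view of (ii), it suffices to consider … odd
primes") — the binder is the proof's claim at an odd `p ∣ M`, not Thm. 10.12; conclusion = the rank-`0`
print shape WITH torsion `PPartRankZero W p` (the display of Thm. 10.12 read at `p`).
The LOCALISED reading `thm921cTwist_pPartRankZero_OPEN` keeps Thm. 10.12's frame but only the
hypotheses Thm. 9.21 (c) needs AT the prime `p ∣ M`: `5 ≤ p` (`p ∤ 6N`), `GoodOrd W₀ p` ((vi) at `p`),
`Irr W₀ p` ((irr_ℚ); = (iv) at `p`, absolute irreducibility ⟺ irreducibility for odd `p`, folklore as in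
the sibling files), and (ram_K) spelled out: a multiplicative `ℓ ≠ p` of `E` with `p ∤ v_ℓ(Δ_E)` (`ρ̄`
ramified at `ℓ ∥ N`) and `ℓ` unramified in `ℚ(√M)` (`¬ RamifiedInQuadratic M ℓ`, i.e. `ℓ ∤ D_K`); READING
FLAG `BSTW-1012-pM-local`: this is the proof sentence instantiated, not a printed theorem statement.

WEAKER-OR-EQUAL to print in every binder (modulo the flag); never stronger. WHAT IS NOT HERE: Thm. 10.1
(Kobayashi's main conj. for `g`, `g ⊗ χ_K`: the signed main-conj. object is Summits-side,
`Supersingular/KobayashiMain….lean`), Thm. 10.4 (= Kobayashi 2003 Thms. 1.2/1.3, tree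
`Kobayashi2003/SignedKatoDivisibility.lean`), Thm. 10.5 / Prop. 10.7 / Thm. 10.8 / Thm. 10.10 (b)
(two-variable `Λ_L`-adic objects: no carriers), Thm. 10.10 (a) (= the tree's PUBLISHED
`BurungaleCastellaSkinner2025.thm112b_charIdeal_eq_padicLFunction_integral` for semistable `E`, another proof),
the main-conj.-level form of Thm. 9.21 (c) (see above); the class bookkeeping "`(E^{(M)}, p)`, `p ∣ M`, is an
ADDITIVE pair (Kodaira `I₀*`, class X4 given (iv))" is left to the Summits side
(`hasAdditiveReductionAt_quadraticTwist_of_dvd` exists in `QuadraticTwistKroneckerLFunctionProofs`).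

## References
* [BurungaleSkinnerTianWan2024] arXiv:2409.01350v2: Cor. 10.2 (p. 86; label BSD_f_Ko, tex l.7328), Thm.
  9.21 (c) with (ram)/(ram_K)/(im) (p. 84; label KaMC_r, tex l.7164), Thm. 10.12 and its proof (p. 89;
  label theoretic, tex l.7535–7558), Thm. 1.3/1.5 twist clause (pp. 3–4).
* [SkinnerUrban2014] Thm. 2 / Thm. 3.29; [Skinner2016PacificMC] Thm. C; [Kato2004Asterisque] §14.20 —
  the published `p`-parts the proof of Thm. 10.12 cites at `p ∤ M`.
* [Miller2011LMS] Def. 1.1 (`BSDp`); [Darmon2004] Thm. 3.22 (GZK).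
-/

set_option autoImplicit false

noncomputable section

open scoped Classical

open WeierstrassCurve Literature.NumberTheory.EllipticCurves
  Literature.NumberTheory.EllipticCurves.Rank1Residual
  Literature.NumberTheory.EllipticCurves.Rank1Residual.Typed

namespace Literature.NumberTheory.EllipticCurves.BurungaleSkinnerTianWan2024

/-! ### Cor. 10.2, twist clause (body wording) -/

/-- **OPEN HYPOTHESIS — UNREFEREED PREPRINT (arXiv:2409.01350v2), Cor. 10.2 (p. 86), twist clause, for
an elliptic curve, BODY wording.** "Let [`E/ℚ` be semistable of conductor `N`] … `p ∤ 2N` a prime so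
that `a_p = 0`. If `ord_{s=1} L = r ≤ 1`, then the `p`-part of BSD is true, that is, `rank_ℤ = r`,
`Ш[p^∞]` is finite and `|L^{(r)}(1)/(r!·Ω R)|_p^{-1} = |#Ш[p^∞]·∏_{ℓ∣N} c_ℓ|_p^{-1}`. Moreover, the same
holds for `E ⊗ χ_K` for quadratic field extensions `K/ℚ` with discriminant coprime to `Np`."
Transcribed: `W₀` globally minimal, `Semistable W₀`, `p ≠ 2`, good at `p`, `W₀.frobeniusTrace p = 0`;
`d` square-free, `d ≠ 1`, every prime ramified in `ℚ(√d)` is `≠ p` and `∤ N_E`; `W` globally minimal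
with `C • W = W₀.quadraticTwist d`; `W.analyticRank ≤ 1` ⇒ `rank = r_an ∧ Ш(E^K)[p^∞]` finite `∧` the
no-torsion print shape at `p`. WIDER than the Introduction's clause (no "only ordinary primes divide
`disc K`"): see `thm15_twist_of_cor102_twist_OPEN`. NEVER cite this `Prop` as a theorem.
[claim: BurungaleSkinnerTianWan2024, status: under-review]
[cite: BurungaleSkinnerTianWan2024, Cor. 10.2, last sentence (p. 86; label BSD_f_Ko, tex l.7328; ANNOUNCED, OPEN binder)] -/
def cor102_twist_pPart_OPEN : Prop :=
  ∀ (W₀ W : WeierstrassCurve ℚ) [W₀.IsElliptic] [W₀.IsGloballyMinimal] [W.IsElliptic]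
    [W.IsGloballyMinimal] (p : ℕ) [Fact p.Prime] (d : ℤ) (C : VariableChange ℚ),
    p ≠ 2 → Semistable W₀ → W₀.HasGoodReductionAtPrime p → W₀.frobeniusTrace p = 0 →
    Squarefree d → d ≠ 1 →
    (∀ (q : ℕ) [Fact q.Prime], RamifiedInQuadratic d q → q ≠ p ∧ ¬ q ∣ W₀.conductorNorm ℤ) →
    C • W = W₀.quadraticTwist (d : ℚ) →
    W.analyticRank ≤ 1 →
      W.mordellWeilRank = W.analyticRank ∧ Finite (AddCommGroup.primaryComponent W.sha p) ∧
      ∃ r : ℚ, W.leadingLCoeff / ((W.realPeriodRat * W.regulator : ℝ) : ℂ) = (r : ℂ) ∧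
        padicValRat p r = (padicValNat p W.shaOrder : ℤ) + padicValNat p W.tamagawaProduct

/-- At a good prime `p ≠ 2` of a globally minimal `W`, "supersingular with (1.7) if `p = 3`"
(`GoodSS W p ∧ (p = 3 → a_3 = 0)`, the Introduction's wording) gives the body's "`a_p = 0`": for
`p ≥ 5` by Hasse's bound (tree theorem `natCast_dvd_frobeniusTrace_iff_eq_zero`), for `p = 3` by (1.7).
Bookkeeping. [cite: BurungaleSkinnerTianWan2024, §1.2.1 (h4) and Thm. 1.3 (twist clause; shape only)] -/
theorem frobeniusTrace_eq_zero_of_goodSS_of_h4 (W : WeierstrassCurve ℚ) [W.IsElliptic]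
    [W.IsGloballyMinimal] (p : ℕ) [Fact p.Prime] (hp : p ≠ 2) (hss : GoodSS W p)
    (h4 : p = 3 → W.frobeniusTrace 3 = 0) : W.frobeniusTrace p = 0 := by
  by_cases h3 : p = 3
  · subst h3; exact h4 rfl
  · have hpP : p.Prime := Fact.out
    have hp5 : 5 ≤ p := by
      rcases hpP.eq_two_or_odd with h2 | hodd
      · exact absurd h2 hp
      · have h2le := hpP.two_le
        by_contra hlt
        interval_cases p <;> simp_all
    exact (W.natCast_dvd_frobeniusTrace_iff_eq_zero p hp5 hss.1).mp hss.2

/-- **The body clause implies the Introduction clause** (OPEN-QUESTIONS-01 Q4 made kernel-precise):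
the binder `cor102_twist_pPart_OPEN` (disc `K` coprime to `Np`) implies the tree's narrower binder
`thm15_twist_pPart_OPEN` (disc `K` coprime to `Np` AND divisible only by ordinary primes of `E`) —
a good ordinary ramified prime is in particular prime to `N_E` (`dvd_conductorNorm_iff_not_hasGoodReductionAtPrime`),
and "supersingular with (1.7)" gives `a_p = 0` (`frobeniusTrace_eq_zero_of_goodSS_of_h4`). Between OPEN
binders; asserts nothing. [claim: BurungaleSkinnerTianWan2024, status: under-review]
[cite: BurungaleSkinnerTianWan2024, Cor. 10.2 (p. 86) versus Thm. 1.5 with Thm. 1.3 (pp. 3–4) (twist clauses; OPEN binders)] -/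
theorem thm15_twist_of_cor102_twist_OPEN (h : cor102_twist_pPart_OPEN) : thm15_twist_pPart_OPEN := by
  intro W₀ W _ _ _ _ p _ d C hp hsst hss h4 hd hd1 hram hC hr
  have hram' : ∀ (q : ℕ) [Fact q.Prime], RamifiedInQuadratic d q → q ≠ p ∧ ¬ q ∣ W₀.conductorNorm ℤ := by
    intro q _ hq
    obtain ⟨hqp, hord⟩ := hram q hq
    exact ⟨hqp, fun hdvd ↦ (W₀.dvd_conductorNorm_iff_not_hasGoodReductionAtPrime q).mp hdvd hord.1⟩
  exact (h W₀ W p d C hp hsst hss.1 (frobeniusTrace_eq_zero_of_goodSS_of_h4 W₀ p hp hss h4) hd hd1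
    hram' hC hr).2.2

/-- **Bridge (CONDITIONAL)**: granted the body twist clause (`hBSTW_OPEN`, unrefereed), at every such
twist `W` with `E^K[p]` irreducible (`hirr`; automatic at a supersingular `p > 2` of `E`, proved
Summits-side for the sibling binder) and analytic rank `≤ 1`, Miller's `BSD(W, p)` — via the tree's
bridge `bsdp_of_padicVal_printShape` (GZK `hGZK` by name). Closes nothing; the BSTW-shape sub-family of
class X7 so reached is WIDER than the sibling's (no ordinarity restriction on the primes of `disc K`).
[claim: BurungaleSkinnerTianWan2024, status: under-review] [cite: Miller2011LMS, §1 and Def. 1.1] -/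
theorem bsdp_of_cor102_twist_OPEN (hBSTW_OPEN : cor102_twist_pPart_OPEN)
    (hGZK : rank_eq_analyticRank_of_analyticRank_le_one)
    (W₀ W : WeierstrassCurve ℚ) [W₀.IsElliptic] [W₀.IsGloballyMinimal] [W.IsElliptic]
    [W.IsGloballyMinimal] (p : ℕ) [Fact p.Prime] (hp : p ≠ 2) (hsst : Semistable W₀)
    (hgood : W₀.HasGoodReductionAtPrime p) (hap : W₀.frobeniusTrace p = 0) {d : ℤ} (hd : Squarefree d)
    (hd1 : d ≠ 1)
    (hram : ∀ (q : ℕ) [Fact q.Prime], RamifiedInQuadratic d q → q ≠ p ∧ ¬ q ∣ W₀.conductorNorm ℤ)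
    {C : VariableChange ℚ} (hC : C • W = W₀.quadraticTwist (d : ℚ)) (hirr : Irr W p)
    (hr : W.analyticRank ≤ 1) : BSDp W p :=
  bsdp_of_padicVal_printShape W p hGZK hr hirr
    (hBSTW_OPEN W₀ W p d C hp hsst hgood hap hd hd1 (fun q _ hq ↦ hram q hq) hC hr).2.2

/-! ### Thm. 10.12, proof: the `p ∣ M` step via Thm. 9.21 (c) -/

/-- **OPEN HYPOTHESIS — UNREFEREED PREPRINT (arXiv:2409.01350v2), proof of Thm. 10.12 (p. 89), the
`p ∣ M` step, LITERAL frame.** Under the hypotheses of Thm. 10.12 except (ii) (`E/ℚ` semistable of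
conductor `N`; `M > 1` square-free, `(M,N) = 1`; (i) `L(1, E^{(M)}) ≠ 0`; (iii) `a_3(E) = 0`; (iv)
`E[p']` absolutely irreducible for all odd `p'`; (v) for every `p' ∣ N` a multiplicative `q ≠ p'` at
which `E[p']` is ramified; (vi) `E` ordinary at the primes dividing `M`): "for odd primes `p` dividing
`M` [the `p`-part of the BSD formula for `E^{(M)}`] is a consequence of Theorem 9.21(c) (cf. the proof
of Corollary 10.2)". Transcribed in the frame of `thm1012_fullBSD_rankZeroTwists_OPEN` (module
docstring; (ii) dropped with the printed justification "In view of (ii), it suffices to consider …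
odd primes `p`"): for every odd prime `p ∣ M`, the rank-`0` print shape WITH torsion
`PPartRankZero W p` for the globally minimal model `W` of `E^{(M)}` — an ADDITIVE prime of `E^{(M)}`
(potentially good ordinary). Under (iii)+(vi) such a `p` is `≥ 5` (`five_le_of_thm1012Hypotheses`),
matching `p ∤ 6N` of Thm. 9.21 (c). NEVER cite this `Prop` as a theorem.
[claim: BurungaleSkinnerTianWan2024, status: under-review]
[cite: BurungaleSkinnerTianWan2024, Thm. 10.12, proof, last sentence (p. 89; label theoretic, tex l.7555–7558) with Thm. 9.21 (c) (p. 84) (ANNOUNCED, OPEN binder)] -/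
def thm1012proof_pPartRankZero_twistPrime_OPEN : Prop :=
  ∀ (W₀ W : WeierstrassCurve ℚ) [W₀.IsElliptic] [W₀.IsGloballyMinimal] [W.IsElliptic]
    [W.IsGloballyMinimal] (M : ℕ) (C : VariableChange ℚ) (p : ℕ) [Fact p.Prime],
    Semistable W₀ → 1 < M → Squarefree M → Nat.Coprime M (W₀.conductorNorm ℤ) →
    C • W = W₀.quadraticTwist (M : ℚ) →
    -- (i)
    W.entireLFunction 1 ≠ 0 →
    -- (iii)
    W₀.frobeniusTrace 3 = 0 →
    -- (iv)
    (∀ p' : ℕ, (hp' : p'.Prime) → p' ≠ 2 → (haveI : Fact p'.Prime := ⟨hp'⟩; Irr W₀ p')) →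
    -- (v)
    (∀ p' : ℕ, (hp' : p'.Prime) → p' ∣ W₀.conductorNorm ℤ → (haveI : Fact p'.Prime := ⟨hp'⟩; Ram W₀ p')) →
    -- (vi)
    (∀ q : ℕ, (hq : q.Prime) → q ∣ M → (haveI : Fact q.Prime := ⟨hq⟩; GoodOrd W₀ q)) →
    -- the step: an odd prime dividing `M`
    p ≠ 2 → p ∣ M →
    PPartRankZero W p

/-- Under (iii) `a_3(E) = 0` and (vi) "`E` ordinary at the primes dividing `M`", an odd prime `p ∣ M`
is `≥ 5` (`p = 3` would be both ordinary and of trace `0`) — the binder's primes lie in the range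
`p ∤ 6N` of Thm. 9.21 (c). Bookkeeping. [cite: BurungaleSkinnerTianWan2024, Thm. 10.12 (iii), (vi) and Thm. 9.21 (c) (pp. 84, 89; shape only)] -/
theorem five_le_of_thm1012Hypotheses (W₀ : WeierstrassCurve ℚ) [W₀.IsGloballyMinimal] {M p : ℕ}
    [Fact p.Prime] (h3 : W₀.frobeniusTrace 3 = 0)
    (hvi : ∀ q : ℕ, (hq : q.Prime) → q ∣ M → (haveI : Fact q.Prime := ⟨hq⟩; GoodOrd W₀ q))
    (hp : p ≠ 2) (hpM : p ∣ M) : 5 ≤ p := by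
  have hpP : p.Prime := Fact.out
  by_contra hlt
  have h2le := hpP.two_le
  interval_cases p
  · exact hp rfl
  · have h := (hvi 3 hpP hpM).2
    rw [h3] at h
    exact h (dvd_zero _)
  · exact absurd hpP (by decide)

/-- **OPEN HYPOTHESIS — UNREFEREED PREPRINT (arXiv:2409.01350v2), Thm. 9.21 (c) twist clause (p. 84)
descended to the rank-`0` `p`-part as in the proof of Thm. 10.12 (p. 89), LOCALISED reading** (READING
FLAG `BSTW-1012-pM-local`, module docstring): in Thm. 10.12's frame (`E` semistable, `M > 1` square-free,
`(M,N) = 1`, `W` a globally minimal model of `E^{(M)}` with `L(1,E^{(M)}) ≠ 0`) and at a prime `p ∣ M`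
satisfying exactly the hypotheses of Thm. 9.21 (c) for `(f_E, K = ℚ(√M), p)`: `5 ≤ p` (`p ∤ 6N`), `E`
good ordinary at `p` (`GoodOrd W₀ p`), (irr_ℚ) (`Irr W₀ p`), (ram_K) — a prime `ℓ ≠ p` of multiplicative
reduction of `E` with `p ∤ v_ℓ(Δ_E)` (`ρ̄_{E,p}` ramified at `ℓ ∥ N`) which is unramified in `ℚ(√M)`
(`ℓ ∤ D_K`) — the rank-`0` print shape WITH torsion `PPartRankZero W p`. This is the proof sentence
"for odd primes `p` dividing `M` it is a consequence of Theorem 9.21(c) (cf. the proof of Corollary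
10.2)" instantiated with 9.21 (c)'s own hypothesis list at `p`; the global hypotheses (iii)–(vi) of
Thm. 10.12 are replaced by what they supply at `p` (and (ram_K), which (i)–(vi) leave implicit, is
EXPLICIT here). NEVER cite this `Prop` as a theorem. [claim: BurungaleSkinnerTianWan2024, status: under-review]
[cite: BurungaleSkinnerTianWan2024, Thm. 9.21 (c) twist clause with (ram_K) (p. 84; label KaMC_r) and proof of Thm. 10.12 (p. 89) (ANNOUNCED, OPEN binder; localised reading)] -/
def thm921cTwist_pPartRankZero_OPEN : Prop :=
  ∀ (W₀ W : WeierstrassCurve ℚ) [W₀.IsElliptic] [W₀.IsGloballyMinimal] [W.IsElliptic]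
    [W.IsGloballyMinimal] (M : ℕ) (C : VariableChange ℚ) (p : ℕ) [Fact p.Prime],
    Semistable W₀ → 1 < M → Squarefree M → Nat.Coprime M (W₀.conductorNorm ℤ) →
    C • W = W₀.quadraticTwist (M : ℚ) →
    W.entireLFunction 1 ≠ 0 →
    -- Thm. 9.21 (c) at `(f_E, ℚ(√M), p)`: `p ∤ 6N` ordinary, (irr_ℚ), `p ∣ disc K`, (ram_K)
    5 ≤ p → p ∣ M → GoodOrd W₀ p → Irr W₀ p →
    (∃ ℓ : ℕ, ∃ _ : Fact ℓ.Prime, ℓ ≠ p ∧ W₀.HasMultiplicativeReductionAtPrime ℓ ∧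
      ¬ p ∣ padicValInt ℓ W₀.minimalDiscriminantInt ∧ ¬ RamifiedInQuadratic (M : ℤ) ℓ) →
    PPartRankZero W p

/-- The localised binder's (ram_K) datum is in particular the tree's `Ram W₀ p` (hypothesis (ram) for
`ρ̄_{E,p}`). Bookkeeping. [cite: BurungaleSkinnerTianWan2024, Thm. 9.21 (c), (ram) and (ram_K) (p. 84; shape only)] -/
theorem ram_of_ramK (W₀ : WeierstrassCurve ℚ) [W₀.IsGloballyMinimal] (p : ℕ) [Fact p.Prime] {M : ℕ}
    (h : ∃ ℓ : ℕ, ∃ _ : Fact ℓ.Prime, ℓ ≠ p ∧ W₀.HasMultiplicativeReductionAtPrime ℓ ∧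
      ¬ p ∣ padicValInt ℓ W₀.minimalDiscriminantInt ∧ ¬ RamifiedInQuadratic (M : ℤ) ℓ) :
    Ram W₀ p := by
  obtain ⟨ℓ, hℓ, hne, hmult, hv, -⟩ := h
  exact ⟨ℓ, hℓ, hne, hmult, hv⟩

variable (W₀ W : WeierstrassCurve ℚ) [W₀.IsElliptic] [W₀.IsGloballyMinimal] [W.IsElliptic]
  [W.IsGloballyMinimal] (p : ℕ) [Fact p.Prime]

/-- **Bridge (CONDITIONAL): the `p ∣ M` step gives Miller's `BSD(E^{(M)}, p)`** — granted the localised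
binder (`hBSTW_OPEN`, unrefereed), at such a datum the rank-`0` print shape converts to the general one
(`pPart_of_pPartRankZero`: `r_an = 0` from `L(1) ≠ 0`, `Reg = 1` by GZK `hGZK`) and then to `BSDp W p`
(`bsdp_of_pPart`, modularity `hmod`) — PUBLISHED named facts by name. `(E^{(M)}, p)` is an ADDITIVE pair
(potentially good ordinary; class X4 given irreducibility), so this is a CONDITIONAL statement on a
sub-population of the additive residue; closes nothing; nothing booked.
[claim: BurungaleSkinnerTianWan2024, status: under-review] [cite: Miller2011LMS, §1 and Def. 1.1] [cite: Darmon2004, Thm. 3.22] -/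
theorem bsdp_of_thm921cTwist_OPEN (hBSTW_OPEN : thm921cTwist_pPartRankZero_OPEN)
    (hmod : hasEntireLFunction_rat) (hGZK : rank_eq_analyticRank_of_analyticRank_le_one)
    {M : ℕ} {C : VariableChange ℚ} (hsst : Semistable W₀) (hM : 1 < M) (hsq : Squarefree M)
    (hcop : Nat.Coprime M (W₀.conductorNorm ℤ)) (hC : C • W = W₀.quadraticTwist (M : ℚ))
    (hL : W.entireLFunction 1 ≠ 0) (hp5 : 5 ≤ p) (hpM : p ∣ M) (hord : GoodOrd W₀ p) (hirr : Irr W₀ p)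
    (hramK : ∃ ℓ : ℕ, ∃ _ : Fact ℓ.Prime, ℓ ≠ p ∧ W₀.HasMultiplicativeReductionAtPrime ℓ ∧
      ¬ p ∣ padicValInt ℓ W₀.minimalDiscriminantInt ∧ ¬ RamifiedInQuadratic (M : ℤ) ℓ) :
    BSDp W p := by
  have hr : W.analyticRank = 0 := analyticRank_eq_zero_of_entireLFunction_one_ne_zero W hL
  exact bsdp_of_pPart W p hmod hGZK (by omega)
    (pPart_of_pPartRankZero W p hGZK hr
      (hBSTW_OPEN W₀ W M C p hsst hM hsq hcop hC hL hp5 hpM hord hirr hramK))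

/-- The same bridge in the currency of the residual classes: the typed missing OUTPUT
`MissingPPartAt W p` (`#Ш_an ∈ ℚ` with `ord_p #Ш_an = ord_p #Ш`) at the additive pair `(E^{(M)}, p)`,
granted the localised OPEN binder (`missingPPartAt_of_pPart`). CONDITIONAL; closes nothing.
[claim: BurungaleSkinnerTianWan2024, status: under-review] [cite: Miller2011LMS, Def. 1.1 (arXiv:1010.2431 p. 3)] -/
theorem missingPPartAt_of_thm921cTwist_OPEN (hBSTW_OPEN : thm921cTwist_pPartRankZero_OPEN)
    (hmod : hasEntireLFunction_rat) (hGZK : rank_eq_analyticRank_of_analyticRank_le_one)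
    {M : ℕ} {C : VariableChange ℚ} (hsst : Semistable W₀) (hM : 1 < M) (hsq : Squarefree M)
    (hcop : Nat.Coprime M (W₀.conductorNorm ℤ)) (hC : C • W = W₀.quadraticTwist (M : ℚ))
    (hL : W.entireLFunction 1 ≠ 0) (hp5 : 5 ≤ p) (hpM : p ∣ M) (hord : GoodOrd W₀ p) (hirr : Irr W₀ p)
    (hramK : ∃ ℓ : ℕ, ∃ _ : Fact ℓ.Prime, ℓ ≠ p ∧ W₀.HasMultiplicativeReductionAtPrime ℓ ∧
      ¬ p ∣ padicValInt ℓ W₀.minimalDiscriminantInt ∧ ¬ RamifiedInQuadratic (M : ℤ) ℓ) :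
    MissingPPartAt W p := by
  have hr : W.analyticRank = 0 := analyticRank_eq_zero_of_entireLFunction_one_ne_zero W hL
  exact missingPPartAt_of_pPart W p hmod hGZK (by omega)
    (pPart_of_pPartRankZero W p hGZK hr
      (hBSTW_OPEN W₀ W M C p hsst hM hsq hcop hC hL hp5 hpM hord hirr hramK))

/-- **Bridge for the LITERAL frame (CONDITIONAL)**: granted `thm1012proof_pPartRankZero_twistPrime_OPEN`,
under Thm. 10.12's hypotheses (i), (iii)–(vi) Miller's `BSD(E^{(M)}, p)` at every odd `p ∣ M`
(`hmod`, `hGZK` by name). Closes nothing. [claim: BurungaleSkinnerTianWan2024, status: under-review]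
[cite: Miller2011LMS, §1 and Def. 1.1] -/
theorem bsdp_of_thm1012proof_twistPrime_OPEN (hBSTW_OPEN : thm1012proof_pPartRankZero_twistPrime_OPEN)
    (hmod : hasEntireLFunction_rat) (hGZK : rank_eq_analyticRank_of_analyticRank_le_one)
    {M : ℕ} {C : VariableChange ℚ} (hsst : Semistable W₀) (hM : 1 < M) (hsq : Squarefree M)
    (hcop : Nat.Coprime M (W₀.conductorNorm ℤ)) (hC : C • W = W₀.quadraticTwist (M : ℚ))
    (hL : W.entireLFunction 1 ≠ 0) (h3 : W₀.frobeniusTrace 3 = 0)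
    (hiv : ∀ p' : ℕ, (hp' : p'.Prime) → p' ≠ 2 → (haveI : Fact p'.Prime := ⟨hp'⟩; Irr W₀ p'))
    (hv : ∀ p' : ℕ, (hp' : p'.Prime) → p' ∣ W₀.conductorNorm ℤ →
      (haveI : Fact p'.Prime := ⟨hp'⟩; Ram W₀ p'))
    (hvi : ∀ q : ℕ, (hq : q.Prime) → q ∣ M → (haveI : Fact q.Prime := ⟨hq⟩; GoodOrd W₀ q))
    (hp : p ≠ 2) (hpM : p ∣ M) : BSDp W p := by
  have hr : W.analyticRank = 0 := analyticRank_eq_zero_of_entireLFunction_one_ne_zero W hL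
  exact bsdp_of_pPart W p hmod hGZK (by omega)
    (pPart_of_pPartRankZero W p hGZK hr
      (hBSTW_OPEN W₀ W M C p hsst hM hsq hcop hC hL h3 hiv hv hvi hp hpM))

end Literature.NumberTheory.EllipticCurves.BurungaleSkinnerTianWan2024

end
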